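import Summits.Schanuel.Schanuel.Theorems.DiophantineDichotomyKhovanskiiApproxTypeEvDefs
import Summits.Schanuel.Schanuel.Theorems.DiophantineDichotomyKhovanskiiApproxTypeEvLambertLiouvilleWindow
import Summits.Schanuel.Schanuel.Theorems.DiophantineDichotomyKhovanskiiApproxTypeEvLambertExpOneDegreeMeasure
import Summits.Schanuel.Schanuel.Theorems.DiophantineDichotomyKhovanskiiApproxTypeEvLambertSyncDiaz
import Summits.Schanuel.Schanuel.Theorems.DiophantineDichotomyKhovanskiiApproxTypeEvLambertChallengerLevel
import Summits.Schanuel.Schanuel.Theorems.DiophantineDichotomyKhovanskiiApproxTypeEvLambertChallengerDist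
import Summits.Schanuel.Schanuel.Theorems.DiophantineDichotomyKhovanskiiApproxTypeEvLambertEndgame
import HarnessLib

/-!
# Route `DiophantineDichotomy`, crux `KhovanskiiApproxTypeEv` (stmt-Schanuel-14972), line `lambert-liouville-kill`:
# the rank-2 HARDNESS CERTIFICATE `notLiouville_lambert_of_ev` — the crux implies that no Lambert number
# `W(1/k)` is a Liouville number

Crux `Summit.Schanuel.Schanuel.Theses.DiophantineDichotomy.KhovanskiiApproxTypeEv` (item stmt-Schanuel-14972;
eventual-in-the-height simultaneous approximation type `a < 1/(n−1)` at every free Khovanskii point).  This file is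
the COMPOSITION of the certificate line `lambert-liouville-kill` (crux-plan verdict `no-skeleton`: the idea runs
AGAINST the crux and yields no `_of`; skeleton `Cruxes/KhovanskiiApproxTypeEv/Lines/lambert_liouville_kill.lean`,
lead `prover-line-stmt-Schanuel-14972-a1-0`).  It closes, SORRY-FREE and with NO named-fact hypothesis, the
registered sub-goal

  `notLiouville_lambert_of_ev : KhovanskiiApproxTypeEv → ∀ k x, 1 ≤ k → 0 < x → k·x·eˣ = 1 → ¬ Liouville x`

from the six landed stubs of the rank-2 block (`stub_liouvilleWindow` p127801, `stub_expOneDegreeMeasure`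
p127822, `stub_syncDiaz` p127960, `stub_challengerLevel` p127871, `stub_challengerDist` p127839, `stub_endgame`
p127875 — all `--supports stmt-Schanuel-14972`).  It does NOT prove or refute the crux: it records, kernel-checked,
that the crux (already at `n = 2`, threshold `a < 1`) contains the Diophantine statement Z′ = "no Lambert number
`x = W(1/k)` (`k ≥ 1`, `k x eˣ = 1`) is a Liouville number" — absent from print and not implied by Schanuel's
conjecture.

## The argument
At the free Khovanskii point `s = (1, x)` (`isFreeKhovanskii_oneLambert`: system `z₀ − 1 = 0`, `k z₁ y₁ − 1 = 0`,
exponential Jacobian `k eˣ (1 + x) ≠ 0`; `(1, x)` is `ℚ`-free for irrational `x`) the crux gives `(a, b, C)` with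
`a < 1` and thresholds `H₀(d)`.  A Liouville `x` has scales `q` with `|x − p/q| ≤ q^{−m}` inside the window
`p ≥ 1`, `kp ≤ q`, `p/q ≥ x/2` (stub 1).  Diaz's theorem (Bugeaud 2004 Thm 8.11, PROVED in tree) synchronised by the
per-degree measure of algebraic approximation of `e` (stub 2, from the PROVED Nesterenko–Waldschmidt approximation
measure) gives at the SAME scale an algebraic `α` of degree `≤ n`, height `H ∈ [q, q^{M₀}]`, `|e − α| ≤ H^{−n/200}`
(stub 3).  The challenger `(1, p/q, α, q/(kp))` has level `(n, H)` (stub 4) and distance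
`≤ max(|e − α|, (1 + 2/(kx²))|x − p/q|)` (stub 5, using `eˣ = 1/(kx)`), which is `< exp(−C(nᵃ log H + nᵇ))` for the
budget `n` of stub 6 and `q` large — contradicting the crux past its threshold `H₀(n) ≤ q ≤ H`.

## Contents
* `isFreeKhovanskii_oneLambert`, `linearIndependent_one_real` — the point (proved glue of the skeleton);
* `notLiouville_lambert_of_ev` — the registered certificate (composition, verbatim the skeleton's).
-/

noncomputable section

-- `Summit.Schanuel.Schanuel.…` is the mandated summit/sub-problem namespace (single-conjunct summit), hence:
set_option linter.dupNamespace false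

open scoped BigOperators

namespace Summit.Schanuel.Schanuel.Cruxes.KhovanskiiApproxTypeEv.LambertLiouvilleKill

open Summit.Schanuel.Schanuel.Theses.DiophantineDichotomy (KhovanskiiApproxTypeEv)
open Summit.Schanuel.Schanuel.Cruxes.KhovanskiiApproxType.LwSmallHeight (IsFreeKhovanskii)
open Summit.Schanuel.Schanuel.Cruxes.KhovanskiiApproxTypeEv.AnchoredReduction
  (ApproxTypeEvAt khovanskiiApproxTypeEv_iff)
open Polynomial Complex

/-! ## The point `s = (1, x)`, `k x eˣ = 1` -/

/-- `s = (1, x)` with `k x eˣ = 1`, `k ≥ 1`, `x > 0` is a FREE KHOVANSKII POINT: the system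
`z₀ − 1 = 0`, `k z₁ y₁ − 1 = 0` over `ℚ` has exponential Jacobian `diag(1, k y₁ (1 + z₁))`,
determinant `k eˣ (1 + x) ≠ 0`. [folklore] -/
theorem isFreeKhovanskii_oneLambert (k : ℕ) (x : ℝ) (hk : 1 ≤ k) (hx0 : 0 < x)
    (hx : (k : ℝ) * x * Real.exp x = 1) : IsFreeKhovanskii 2 ![(1 : ℂ), (x : ℂ)] := by
  classical
  have hxC : (k : ℂ) * (x : ℂ) * Complex.exp (x : ℂ) = 1 := by
    rw [← Complex.ofReal_exp]; exact_mod_cast hx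
  have hk0 : (k : ℂ) ≠ 0 := by exact_mod_cast (show k ≠ 0 by omega)
  have hx1C : (x : ℂ) + 1 ≠ 0 := by
    have : (x + 1 : ℝ) ≠ 0 := by linarith
    exact_mod_cast this
  refine ⟨![MvPolynomial.X (Sum.inl 0) - 1,
    MvPolynomial.C (k : ℚ) * MvPolynomial.X (Sum.inl 1) * MvPolynomial.X (Sum.inr 1) - 1], ?_, ?_⟩
  · intro i
    fin_cases i
    · simp
    · simp [hxC]
  · rw [Matrix.det_fin_two]
    simp [Matrix.of_apply, MvPolynomial.pderiv_X, Derivation.leibniz]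
    have : Complex.exp ↑x * ↑k + Complex.exp ↑x * (↑k * ↑x) = ↑k * Complex.exp ↑x * (↑x + 1) := by
      ring
    rw [this]
    exact mul_ne_zero (mul_ne_zero hk0 (Complex.exp_ne_zero _)) hx1C

/-- `(1, x)` is `ℚ`-linearly independent for irrational real `x`. [folklore] -/
theorem linearIndependent_one_real (x : ℝ) (hx : Irrational x) :
    LinearIndependent ℚ ![(1 : ℂ), (x : ℂ)] := by
  rw [LinearIndependent.pair_iff]
  intro s t hst
  have h1 : (s : ℝ) + (t : ℝ) * x = 0 := by
    have : (((s : ℝ) + (t : ℝ) * x : ℝ) : ℂ) = 0 := by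
      push_cast
      rw [Rat.smul_def, Rat.smul_def] at hst
      linear_combination hst
    exact_mod_cast this
  by_cases ht : t = 0
  · subst ht
    simp at h1
    exact ⟨by exact_mod_cast h1, rfl⟩
  · exfalso
    have : x = ((-s / t : ℚ) : ℝ) := by
      have ht' : (t : ℝ) ≠ 0 := by exact_mod_cast ht
      push_cast
      field_simp
      linarith
    exact hx.ne_rat _ this

/-! ## The certificate -/

/-- **`KhovanskiiApproxTypeEv` ⟹ no Lambert number `W(1/k)` is Liouville** (registered hardness
certificate of crux stmt-Schanuel-14972; sorry-free from the six landed stubs of the rank-2 block of line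
`lambert-liouville-kill`).  At the free Khovanskii point `s = (1, x)`, `k x eˣ = 1` (`n = 2`, threshold
`a < 1`): a Liouville `x` has scales `q` with `|x − p/q| ≤ q^{−m}`; `stub_syncDiaz` gives, at the SAME
scale, `α ≈ e` of degree `≤ n` and height `H ∈ [q, q^{M₀}]` with `|e − α| ≤ H^{−n/200}`; the challenger
`(1, p/q, α, q/(kp))` has level `(n, H)` and distance `≤ max(H^{−n/200}, (1 + 2/(kx²)) q^{−m}) <
exp(−C(nᵃ log H + nᵇ))` — contradiction for `q` large (past the crux's threshold `H₀(n)`).  Hence the crux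
contains Z′ = "no `W(1/k)` is Liouville", a statement not implied by Schanuel's conjecture. [folklore] -/
theorem notLiouville_lambert_of_ev :
    KhovanskiiApproxTypeEv → ∀ (k : ℕ) (x : ℝ), 1 ≤ k → 0 < x → (k : ℝ) * x * Real.exp x = 1 →
      ¬ Liouville x := by
  intro hEv k x hk hx0 hx hL
  -- the point and the crux at n = 2
  have hfree : IsFreeKhovanskii 2 ![(1 : ℂ), (x : ℂ)] := isFreeKhovanskii_oneLambert k x hk hx0 hx
  have hli : LinearIndependent ℚ ![(1 : ℂ), (x : ℂ)] := linearIndependent_one_real x hL.irrational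
  obtain ⟨a, b, C, ha, hC, hall⟩ := (khovanskiiApproxTypeEv_iff.1 hEv) 2 _ le_rfl hli hfree
  have ha1 : a < 1 := by
    have h1 : (1 : ℝ) / (((2 : ℕ) : ℝ) - 1) = 1 := by norm_num
    rw [h1] at ha
    exact ha
  -- k x < 1
  have hkpos : (0 : ℝ) < k := by exact_mod_cast (show 0 < k by omega)
  have hkx : (k : ℝ) * x < 1 := by
    have hexp : 1 < Real.exp x := Real.one_lt_exp_iff.mpr hx0
    have hkx0 : 0 < (k : ℝ) * x := mul_pos hkpos hx0
    calc (k : ℝ) * x = (k : ℝ) * x * 1 := by ring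
      _ < (k : ℝ) * x * Real.exp x := by gcongr
      _ = 1 := hx
  -- the constant of the distance bound, the budget n and the endgame data
  set K : ℝ := 1 + 2 / ((k : ℝ) * x ^ 2) with hK
  have hK0 : 0 ≤ K := by positivity
  obtain ⟨n, hn50, hend⟩ := stub_endgame a b C K ha1 hC hK0
  obtain ⟨M₀, hM₀, q₁, hq₁⟩ := stub_syncDiaz stub_expOneDegreeMeasure n hn50
  obtain ⟨m, q₀, hfin⟩ := hend M₀ hM₀
  have hn1 : 1 ≤ n := by omega
  -- threshold of the eventual crux at budget n
  obtain ⟨H₀, hH₀⟩ := hall n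
  -- the Liouville scale
  set N : ℕ := max (max H₀ q₁) ⌈q₀⌉₊ with hN
  obtain ⟨p, q, hNq, hp, hkpq, hwin, hclose⟩ := stub_liouvilleWindow x k hL hx0 hkx m N
  have hq1 : 1 ≤ q := le_trans (le_trans hp (Nat.le_mul_of_pos_left p (by omega))) hkpq
  have hq₁q : q₁ ≤ q := le_trans (le_trans (le_max_right _ _) (le_max_left _ _)) hNq
  have hq₀q : q₀ ≤ (q : ℝ) := by
    have h1 : ⌈q₀⌉₊ ≤ q := le_trans (le_max_right _ _) hNq
    exact (Nat.le_ceil q₀).trans (by exact_mod_cast h1)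
  -- the synchronised approximant of e at the scale q
  obtain ⟨α, P, H, hP0, hPα, hPdeg, hPcoef, hqH, hHq, hqual⟩ := hq₁ q hq₁q
  have hH₀H : H₀ ≤ H := le_trans (le_trans (le_trans (le_max_left _ _) (le_max_left _ _)) hNq) hqH
  -- admissibility of the challenger at level (n, H)
  obtain ⟨hfr, hcl⟩ := stub_challengerLevel n k p q H α P hn1 hk hp hkpq hqH hP0 hPα hPdeg hPcoef
  have key := hH₀ H (Sum.elim ![(1 : ℂ), (p : ℂ) / q] ![α, (q : ℂ) / (k * p)]) hH₀H hfr hcl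
  -- its distance
  have hdist := stub_challengerDist k p q x α hk hx0 hx hp hq1 hwin
  have h2 : K * |x - (p : ℝ) / q| ≤ K * (1 / (q : ℝ) ^ m) :=
    mul_le_mul_of_nonneg_left hclose hK0
  have h3 := max_le_max hqual h2
  have hqH' : (q : ℝ) ≤ H := by exact_mod_cast hqH
  have h4 := hfin (q : ℝ) (H : ℝ) hq₀q hqH' hHq
  linarith [key, hdist, h3, h4]

end Summit.Schanuel.Schanuel.Cruxes.KhovanskiiApproxTypeEv.LambertLiouvilleKill

end
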